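import Mathlib

/-!
# Order-preserving and order-decreasing transformations

Results of [Ganyushkin–Mazorchuk 2009, Ch. 14, §§14.1–14.2] on the subsemigroups of the full
transformation semigroup `𝒯(X)` of a linearly ordered set `X` (in the book `X = {1 < ⋯ < n}`)
that are defined by the order.  As in the other files of this directory, `𝒯(X)` is the type
`X → X` under composition `∘`, `im α = Set.range α`.

* `𝒪(X)` (order-preserving = monotone maps) and `ℱ(X)` (order-decreasing maps, `α x ≤ x`)
  are closed under composition (Exercises 14.1.1 and 14.1.3), and so is
  `𝒞(X) = 𝒪(X) ∩ ℱ(X)`;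
* Proposition 14.1.6 (total transformations): if `α` is order-preserving or
  order-decreasing, the permutational part of `α` is the identity, i.e. every periodic point
  of `α` is a fixed point (`apply_eq_self_of_iterate_eq_of_monotone`,
  `apply_eq_self_of_iterate_eq_of_decreasing`);
* Corollary 14.1.7: every group element of `𝒪(X)`, `ℱ(X)` (`X` finite) is an idempotent; here
  "group element of `𝒯(X)`" is used in the form "injective on its image" (Theorem 5.1.4 /
  Proposition 5.2.8 of the book; see `FullTransformation.isGroupElement_iff_injOn` in
  `FullTransformationMaximalSubgroups`), so that this file only depends on Mathlib
  (`comp_self_eq_of_monotone_of_injOn`, `comp_self_eq_of_decreasing_of_injOn`); in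
  particular these semigroups are aperiodic: an `𝓗`-class of `𝒯(X)` meets `𝒪(X)` (resp.
  `ℱ(X)`) in at most one group element (`eq_of_greenH_of_monotone`);
* Proposition 14.2.1: `|ℱₙ| = n!` (`card_decreasing`);
* Proposition 14.2.3: `|𝒪ₙ| = (2n-1 choose n)` (`card_monotone`), through the stars-and-bars
  bijection of its proof (`card_monotone_fin`: order-preserving maps `Fin m → Fin (n+1)` are
  `(m+n choose m)`; `card_strictMono_fin`: strictly increasing maps `Fin m → α` are
  `(card α choose m)`);
* Proposition 14.2.2: `|𝒫ℱₙ| = (n + 1)!`, where a partial transformation of `Fin n` is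
  rendered as a function `Fin n → Option (Fin n)` (`none` = undefined) (`card_partialDecreasing`).

## References
* [GanyushkinMazorchuk2009] O. Ganyushkin, V. Mazorchuk, *Classical Finite Transformation
  Semigroups. An Introduction*, Algebra and Applications 9, Springer, 2009, Chapter 14.
-/

namespace Literature.Algebra.Semigroups.OrderPreserving

open Function Set
open scoped Nat

variable {X : Type*}

/-! ### Closure under composition (Exercises 14.1.1, 14.1.3) -/

/-- Exercise 14.1.1 (total case): the order-preserving transformations `𝒪(X)` form a
subsemigroup of `𝒯(X)`: they are closed under composition (and contain the identity).
[cite: GanyushkinMazorchuk2009, Exercise 14.1.1] -/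
theorem monotone_comp [Preorder X] {α β : X → X} (hα : Monotone α) (hβ : Monotone β) :
    Monotone (α ∘ β) :=
  hα.comp hβ

/-- Exercise 14.1.3 (total case): the order-decreasing transformations `ℱ(X)`
(`α x ≤ x` for all `x`) are closed under composition.
[cite: GanyushkinMazorchuk2009, Exercise 14.1.3] -/
theorem decreasing_comp [Preorder X] {α β : X → X} (hα : ∀ x, α x ≤ x) (hβ : ∀ x, β x ≤ x) :
    ∀ x, (α ∘ β) x ≤ x :=
  fun x => (hα (β x)).trans (hβ x)

/-- `𝒞(X) = 𝒪(X) ∩ ℱ(X)` is closed under composition.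
[cite: GanyushkinMazorchuk2009, §14.1 (definition of 𝒞ₙ)] -/
theorem monotone_decreasing_comp [Preorder X] {α β : X → X} (hα : Monotone α ∧ ∀ x, α x ≤ x)
    (hβ : Monotone β ∧ ∀ x, β x ≤ x) : Monotone (α ∘ β) ∧ ∀ x, (α ∘ β) x ≤ x :=
  ⟨monotone_comp hα.1 hβ.1, decreasing_comp hα.2 hβ.2⟩

/-! ### Proposition 14.1.6: the permutational part is trivial -/

/-- Iterates of an order-decreasing map are order-decreasing. [folklore] -/
private theorem iterate_apply_le [Preorder X] {α : X → X} (hα : ∀ x, α x ≤ x) (m : ℕ)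
    (x : X) : α^[m] x ≤ x := by
  induction m generalizing x with
  | zero => simp
  | succ m ih =>
    rw [iterate_succ_apply]
    exact (ih (α x)).trans (hα x)

/-- Proposition 14.1.6 for order-decreasing total transformations: every cycle of the
permutational part of `α ∈ ℱ(X)` is trivial, i.e. if `αᵏ x = x` for some `k ≥ 1` then
`α x = x` (from `x ≥ α x ≥ α² x ≥ ⋯ ≥ αᵏ x = x`).
[cite: GanyushkinMazorchuk2009, Proposition 14.1.6] -/
theorem apply_eq_self_of_iterate_eq_of_decreasing [PartialOrder X] {α : X → X}
    (hα : ∀ x, α x ≤ x) {x : X} {k : ℕ} (hk : 0 < k) (hx : α^[k] x = x) : α x = x := by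
  refine le_antisymm (hα x) ?_
  obtain ⟨j, rfl⟩ := Nat.exists_eq_add_one_of_ne_zero hk.ne'
  calc x = α^[j + 1] x := hx.symm
    _ = α^[j] (α x) := iterate_succ_apply α j x
    _ ≤ α x := iterate_apply_le hα j (α x)

/-- Proposition 14.1.6 for order-preserving total transformations of a chain: if `αᵏ x = x`
for some `k ≥ 1` then `α x = x` (if `x < α x` then `x < α x ≤ α² x ≤ ⋯ ≤ αᵏ x`, and dually).
[cite: GanyushkinMazorchuk2009, Proposition 14.1.6] -/
theorem apply_eq_self_of_iterate_eq_of_monotone [LinearOrder X] {α : X → X} (hα : Monotone α)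
    {x : X} {k : ℕ} (hk : 0 < k) (hx : α^[k] x = x) : α x = x := by
  rcases lt_trichotomy (α x) x with h | h | h
  · have hanti := hα.antitone_iterate_of_map_le h.le
    have h1 : α^[k] x ≤ α^[1] x := hanti (Nat.succ_le_of_lt hk)
    rw [hx, iterate_one] at h1
    exact absurd h1 (not_le_of_gt h)
  · exact h
  · have hmono := hα.monotone_iterate_of_le_map h.le
    have h1 : α^[1] x ≤ α^[k] x := hmono (Nat.succ_le_of_lt hk)
    rw [hx, iterate_one] at h1
    exact absurd h1 (not_le_of_gt h)

/-! ### Corollary 14.1.7: group elements are idempotents -/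

/-- A transformation acting injectively on a finite invariant set `A` permutes `A`, so every
point of `A` is periodic. [folklore] -/
private theorem exists_iterate_eq_self_of_injOn [Finite X] {α : X → X} {A : Set X}
    (hm : MapsTo α A A) (hi : InjOn α A) {y : X} (hy : y ∈ A) :
    ∃ k, 0 < k ∧ α^[k] y = y := by
  obtain ⟨i, j, hne, heq⟩ := Finite.exists_ne_map_eq_of_infinite (fun n : ℕ => α^[n] y)
  wlog hij : i < j generalizing i j
  · exact this j i hne.symm heq.symm (lt_of_le_of_ne (not_lt.1 hij) hne.symm)
  refine ⟨j - i, Nat.sub_pos_of_lt hij, ?_⟩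
  have hinj : InjOn α^[i] A := hi.iterate hm i
  refine hinj (hm.iterate (j - i) hy) hy ?_
  have : α^[i] (α^[j - i] y) = α^[j] y := by
    rw [← iterate_add_apply, Nat.add_sub_cancel' hij.le]
  rw [this]
  exact heq.symm

/-- Corollary 14.1.7 for `𝒪(X)`, `X` a finite chain: a group element of `𝒪(X)` — an
order-preserving transformation `α` which is injective on `im α` (the characterisation of the
group elements of `𝒯(X)`, Theorem 5.1.4 / Proposition 5.2.8) — is an idempotent.  Indeed
`α` permutes `im α`, so every point of `im α` is periodic, hence fixed by Proposition 14.1.6.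
[cite: GanyushkinMazorchuk2009, Corollary 14.1.7] -/
theorem comp_self_eq_of_monotone_of_injOn [LinearOrder X] [Finite X] {α : X → X}
    (hα : Monotone α) (hi : InjOn α (range α)) : α ∘ α = α := by
  funext x
  obtain ⟨k, hk, hfix⟩ :=
    exists_iterate_eq_self_of_injOn (fun y _ => mem_range_self y) hi (mem_range_self (f := α) x)
  exact apply_eq_self_of_iterate_eq_of_monotone hα hk hfix

/-- Corollary 14.1.7 for `ℱ(X)`, `X` finite: an order-decreasing transformation which is
injective on its image (a group element of `𝒯(X)`) is an idempotent.
[cite: GanyushkinMazorchuk2009, Corollary 14.1.7] -/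
theorem comp_self_eq_of_decreasing_of_injOn [PartialOrder X] [Finite X] {α : X → X}
    (hα : ∀ x, α x ≤ x) (hi : InjOn α (range α)) : α ∘ α = α := by
  funext x
  obtain ⟨k, hk, hfix⟩ :=
    exists_iterate_eq_self_of_injOn (fun y _ => mem_range_self y) hi (mem_range_self (f := α) x)
  exact apply_eq_self_of_iterate_eq_of_decreasing hα hk hfix

/-- Two `𝓗`-related idempotents of `𝒯(X)` are equal (they are identities of the same
group `𝓗`-class). [folklore] -/
private theorem idempotent_eq_of_greenH {ε ε' : X → X} (hε : ε ∘ ε = ε) (hε' : ε' ∘ ε' = ε')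
    (hL : (∃ p : X → X, ε' = p ∘ ε) ∧ ∃ q : X → X, ε = q ∘ ε')
    (hR : (∃ s : X → X, ε' = ε ∘ s) ∧ ∃ t : X → X, ε = ε' ∘ t) : ε' = ε := by
  obtain ⟨⟨p, hp⟩, -⟩ := hL
  obtain ⟨-, ⟨t, ht⟩⟩ := hR
  -- ε' ∘ ε = ε'  (from ε' = p ∘ ε) and ε' ∘ ε = ε (from ε = ε' ∘ t)
  have h1 : ε' ∘ ε = ε' := by
    rw [hp, comp_assoc, hε]
  have h2 : ε' ∘ ε = ε := by
    nth_rw 1 [ht]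
    rw [← comp_assoc, hε', ← ht]
  rw [← h1, h2]

/-- Aperiodicity of `𝒪(X)` (the remark after Corollary 14.1.7: all maximal subgroups are
trivial), in the following concrete form: if two order-preserving transformations of a finite
chain are group elements of `𝒯(X)` (injective on their images) and are `𝓗`-related in `𝒯(X)`
(they generate the same left and the same right principal ideals), then they are equal.
[cite: GanyushkinMazorchuk2009, Corollary 14.1.7 and the remark following it] -/
theorem eq_of_greenH_of_monotone [LinearOrder X] [Finite X] {α β : X → X}
    (hα : Monotone α) (hαi : InjOn α (range α)) (hβ : Monotone β) (hβi : InjOn β (range β))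
    (hL : (∃ p : X → X, β = p ∘ α) ∧ ∃ q : X → X, α = q ∘ β)
    (hR : (∃ s : X → X, β = α ∘ s) ∧ ∃ t : X → X, α = β ∘ t) : β = α :=
  idempotent_eq_of_greenH (comp_self_eq_of_monotone_of_injOn hα hαi)
    (comp_self_eq_of_monotone_of_injOn hβ hβi) hL hR

/-- Aperiodicity of `ℱ(X)`: two order-decreasing group elements of `𝒯(X)` which are
`𝓗`-related in `𝒯(X)` coincide.
[cite: GanyushkinMazorchuk2009, Corollary 14.1.7 and the remark following it] -/
theorem eq_of_greenH_of_decreasing [PartialOrder X] [Finite X] {α β : X → X}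
    (hα : ∀ x, α x ≤ x) (hαi : InjOn α (range α)) (hβ : ∀ x, β x ≤ x)
    (hβi : InjOn β (range β))
    (hL : (∃ p : X → X, β = p ∘ α) ∧ ∃ q : X → X, α = q ∘ β)
    (hR : (∃ s : X → X, β = α ∘ s) ∧ ∃ t : X → X, α = β ∘ t) : β = α :=
  idempotent_eq_of_greenH (comp_self_eq_of_decreasing_of_injOn hα hαi)
    (comp_self_eq_of_decreasing_of_injOn hβ hβi) hL hR

/-! ### Cardinalities (Propositions 14.2.1, 14.2.2) -/

/-- Proposition 14.2.1: `|ℱₙ| = n!` — the image of `x` under an order-decreasing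
transformation of `{0 < 1 < ⋯ < n-1}` can be chosen in `x + 1` ways, independently.
[cite: GanyushkinMazorchuk2009, Proposition 14.2.1] -/
theorem card_decreasing (n : ℕ) :
    Fintype.card {α : Fin n → Fin n // ∀ x, α x ≤ x} = n ! := by
  let e : {α : Fin n → Fin n // ∀ x, α x ≤ x} ≃ (∀ x : Fin n, Fin (x.val + 1)) :=
    { toFun := fun α x => ⟨(α.1 x).val, Nat.lt_succ_of_le (α.2 x)⟩
      invFun := fun g => ⟨fun x => ⟨(g x).val, lt_of_le_of_lt (Nat.lt_succ_iff.1 (g x).2) x.2⟩,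
        fun x => Fin.le_def.2 (Nat.lt_succ_iff.1 (g x).2)⟩
      left_inv := fun α => by ext x; rfl
      right_inv := fun g => by ext x; rfl }
  rw [Fintype.card_congr e, Fintype.card_pi]
  simp only [Fintype.card_fin]
  rw [Fin.prod_univ_eq_prod_range (fun i => i + 1) n, Finset.prod_range_add_one_eq_factorial]

/-- Proposition 14.2.2: `|𝒫ℱₙ| = (n + 1)!`, where a partial transformation of
`{0 < ⋯ < n-1}` is a function `Fin n → Option (Fin n)` (`none` = "undefined") and
order-decreasing means `y ≤ x` whenever `α x = some y`: now the image of `x` can be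
chosen in `x + 2` ways. [cite: GanyushkinMazorchuk2009, Proposition 14.2.2] -/
theorem card_partialDecreasing (n : ℕ) :
    Fintype.card {α : Fin n → Option (Fin n) // ∀ x, ∀ y ∈ α x, y ≤ x} = (n + 1)! := by
  let fwd : Option (Fin n) → (x : Fin n) → Fin (x.val + 2) := fun o x =>
    o.elim 0 fun y => ⟨min (y.val + 1) (x.val + 1), by omega⟩
  let bwd : (x : Fin n) → Fin (x.val + 2) → Option (Fin n) := fun x j =>
    if j.val = 0 then none else some ⟨j.val - 1, by omega⟩
  let e : {α : Fin n → Option (Fin n) // ∀ x, ∀ y ∈ α x, y ≤ x} ≃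
      (∀ x : Fin n, Fin (x.val + 2)) :=
    { toFun := fun α x => fwd (α.1 x) x
      invFun := fun g => ⟨fun x => bwd x (g x), by
        intro x y hy
        simp only [bwd, Option.mem_def] at hy
        split_ifs at hy with h
        obtain ⟨rfl⟩ := Option.some_inj.1 hy
        rw [Fin.le_def]
        have := (g x).isLt
        dsimp only
        omega⟩
      left_inv := by
        rintro ⟨α, hα⟩
        apply Subtype.ext
        funext x
        dsimp only
        rcases hx : α x with _ | y
        · simp [fwd, bwd]
        · have hyx : y.val ≤ x.val := Fin.le_def.1 (hα x y (by rw [Option.mem_def, hx]))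
          simp only [fwd, bwd, Option.elim_some]
          split_ifs with h
          · exact absurd h (by omega)
          · simp only [Option.some.injEq, Fin.ext_iff]
            omega
      right_inv := by
        intro g
        funext x
        simp only [bwd]
        split_ifs with h
        · simp only [fwd, Option.elim_none]
          exact Fin.ext (by simp [h])
        · simp only [fwd, Option.elim_some]
          have := (g x).isLt
          exact Fin.ext (by simp only; omega) }
  rw [Fintype.card_congr e, Fintype.card_pi]
  simp only [Fintype.card_fin]
  rw [Fin.prod_univ_eq_prod_range (fun i => i + 2) n,
    ← Finset.prod_range_add_one_eq_factorial, Finset.prod_range_succ']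
  simp

/-! ### Proposition 14.2.3: `|𝒪ₙ| = (2n-1 choose n)` (stars and bars) -/

/-- Strictly increasing maps `Fin m → α` into a finite chain correspond bijectively to the
`m`-element subsets of `α` (their images: "the vector `b₁ < ⋯ < bₘ` uniquely determines the
subset `{b₁, …, bₘ}`"), so there are `(card α).choose m` of them.
[cite: GanyushkinMazorchuk2009, §14.2, proof of Proposition 14.2.3] -/
theorem card_strictMono_fin (m : ℕ) (α : Type*) [LinearOrder α] [Fintype α] :
    Fintype.card {f : Fin m → α // StrictMono f} = (Fintype.card α).choose m := by
  let e : {f : Fin m → α // StrictMono f} ≃ {s : Finset α // s.card = m} :=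
    { toFun := fun f => ⟨Finset.univ.image f.1, by
        rw [Finset.card_image_of_injective _ f.2.injective, Finset.card_univ, Fintype.card_fin]⟩
      invFun := fun s => ⟨fun i => s.1.orderEmbOfFin s.2 i, (s.1.orderEmbOfFin s.2).strictMono⟩
      left_inv := fun f => Subtype.ext (Finset.orderEmbOfFin_unique _
          (fun x => Finset.mem_image_of_mem _ (Finset.mem_univ x)) f.2).symm
      right_inv := fun s => Subtype.ext <| Finset.coe_injective <| by
        rw [Finset.coe_image, Finset.coe_univ, Set.image_univ]
        exact Finset.range_orderEmbOfFin _ _ }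
  rw [Fintype.card_congr e, Fintype.card_finset_len]

/-- For a strictly increasing `g : Fin m → Fin N`, `g i + (j - i) ≤ g j` for `i ≤ j`.
[folklore] -/
private theorem add_le_of_strictMono {m N : ℕ} {g : Fin m → Fin N} (hg : StrictMono g) :
    ∀ (k : ℕ) (i j : Fin m), j.val = i.val + k → (g i).val + k ≤ (g j).val := by
  intro k
  induction k with
  | zero =>
    intro i j h
    rw [Fin.ext h.symm, add_zero]
  | succ k ih =>
    intro i j h
    have hj' : i.val + k < m := by omega
    have h1 := ih i ⟨i.val + k, hj'⟩ rfl
    have h2 : g ⟨i.val + k, hj'⟩ < g j := hg (Fin.lt_def.2 (by simp; omega))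
    rw [Fin.lt_def] at h2
    omega

/-- The bijection in the proof of Proposition 14.2.3, for maps between chains of possibly
different lengths: order-preserving maps `f : Fin m → Fin (n + 1)` correspond to strictly
increasing maps `Fin m → Fin (m + n)` via `bᵢ = aᵢ + i` (`i = 0, …, m - 1`); hence there
are `(m + n).choose m` of them (the book: `m = n + 1`).
[cite: GanyushkinMazorchuk2009, Proposition 14.2.3 (proof)] -/
theorem card_monotone_fin (m n : ℕ) :
    Fintype.card {f : Fin m → Fin (n + 1) // Monotone f} = (m + n).choose m := by
  let e : {f : Fin m → Fin (n + 1) // Monotone f} ≃ {g : Fin m → Fin (m + n) // StrictMono g} :=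
    { toFun := fun f => ⟨fun i => ⟨(f.1 i).val + i.val, by have := (f.1 i).isLt; omega⟩, by
        intro i j hij
        have h := f.2 hij.le
        rw [Fin.le_def] at h
        rw [Fin.lt_def] at hij ⊢
        dsimp only
        omega⟩
      invFun := fun g => ⟨fun i => ⟨(g.1 i).val - i.val, by
          have hm : 0 < m := lt_of_le_of_lt (Nat.zero_le _) i.isLt
          have h := add_le_of_strictMono g.2 (m - 1 - i.val) i ⟨m - 1, by omega⟩
            (by simp; omega)
          have := (g.1 ⟨m - 1, by omega⟩).isLt
          omega⟩, by
        intro i j hij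
        rw [Fin.le_def] at hij ⊢
        have h := add_le_of_strictMono g.2 (j.val - i.val) i j (by omega)
        have h0 := add_le_of_strictMono g.2 i.val ⟨0, by omega⟩ i (by simp)
        dsimp only
        omega⟩
      left_inv := by
        rintro ⟨f, hf⟩
        apply Subtype.ext
        funext i
        apply Fin.ext
        simp
      right_inv := by
        rintro ⟨g, hg⟩
        apply Subtype.ext
        funext i
        apply Fin.ext
        have h0 := add_le_of_strictMono hg i.val ⟨0, Nat.lt_of_le_of_lt (Nat.zero_le _) i.isLt⟩ i (by simp)
        dsimp only
        omega }
  rw [Fintype.card_congr e, card_strictMono_fin, Fintype.card_fin]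

/-- Proposition 14.2.3: `|𝒪ₙ| = (2n-1 choose n)` — the number of order-preserving
transformations of an `n`-element chain. [cite: GanyushkinMazorchuk2009, Proposition 14.2.3] -/
theorem card_monotone (n : ℕ) :
    Fintype.card {α : Fin n → Fin n // Monotone α} = (2 * n - 1).choose n := by
  cases n with
  | zero =>
    rw [Fintype.card_eq_one_iff.2 ⟨⟨fun i => i.elim0, fun i => i.elim0⟩,
      fun f => Subtype.ext (funext fun i => i.elim0)⟩]
    rfl
  | succ k =>
    rw [card_monotone_fin (k + 1) k]
    congr 1
    omega

end Literature.Algebra.Semigroups.OrderPreserving
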